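/-
Copyright (c) 2026 the pub-hodgecm-mathlib formalisation cell (harness21).  Prover seat hodgecm-mathlib-R90-C10-p04 (g2), SLAB R90-TF, section S1 «Ch. 10∕12 local»,
S1 WAVE E3-PAY hand (W2) (dealer R90-C10-plan (g2), R-S1-10; re-pointed 23:13:17Z): the two `hHCB`-lettered conjuncts of ★ `ExtE3FinDatum` paid from the record
pins ★ `IsRecordDatumG`, crux H413 = `stmt-HodgeConjecture-24833`.  KERNEL module: THEOREMS ONLY (no definition, no named fact, no `sorry`, no instance, no
notation).  2026-09-04.
-/
import Summits.HodgeConjecture.HodgeConjecture.Theorems.R90S1ClosureE3Defs                 -- ★ p862727 (R90-C10-typ2 (g2)) D1: `IsRecordDatumG`, `ExtE3FinDatum` (the E3 closure-socket vocabulary)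
import Summits.HodgeConjecture.HodgeConjecture.Theorems.K2E3PseudoCoeffTraceOfPinsLeThree   -- ★ (K2E3-p25 (g3)) NR-1′ payer `pseudoCoeffTrace_of_pins` (brings ★ `K2E3L2dOfHcbLeThree`, ★ `F0P3cStCharTSDGField` transitively)
import HarnessLib

/-!
# R90 · S1 (Rogawski 1990 Ch. 12, local) · (E3) closure socket — the two `hHCB`-lettered conjuncts of `ExtE3FinDatum` from the record pins

Cell `pub/hodgecm-mathlib` (D-0151), SLAB R90-TF, section S1 «Ch. 10∕12 local», crux H413 = `stmt-HodgeConjecture-24833` (lane `--supports … --as helper`), route of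
record `HCCMUnconditional` (no route verbs); prover seat `hodgecm-mathlib-R90-C10-p04` (g2), S1 WAVE E3-PAY hand (W2) (R90-C10-plan (g2) R-S1-10 2026-09-04T23:03:46Z,
card `R90/R90-C10-plan/g2/DEAL-E3PAY.v1.md` 904b0dc2a3956af1 § (W2); re-pointed to this seat 23:13:17Z).  THEOREMS ONLY (no `def`, no `instance`, no notation, no `sorry`);
★-only imports (no `Lines` import).  Sibling of ★ (W1) `R90S1ExtE3WeylIntegrationOfRecordPins.weylIntegration_of_isRecordDatumG` (p862930).

THE POINT.  ★ D1 `R90S1ClosureE3Defs` (p862727) fields the §12.5∕§12.6 relations of the (E3) closure socket PINS-THEN-RELATION.  Two of its conjuncts are payable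
TODAY from the eighteen G-side pins ★ `IsRecordDatumG` MODULO THE SIBLING FIELD `ExtE3Fin.normCharLocBdd` — Harish-Chandra's local boundedness of the normalised
character `|D_G|^{1∕2} χ_π`, read through the NR-1′ narrowing ★ `normalizedCharacter_locallyBoundedLeThree` (`2 ≤ N ≤ 3`, `v` non-split) and carried here as the
LETTER `hHCB` placed right after `hns` (HONEST: an INTERNAL reduction of the E3 build target — `hHCB` is NOT discharged; it IS the closure field `ExtE3Fin.normCharLocBdd`
that the (W3) assembler binds once):
* §1 **`l2CharOnTorusAll_of_isRecordDatumG`** — `𝔇.L2CharOnTorusAll` (= `ExtE3FinDatum.howeL2`.2, D1 :280): «`D_G χ_π ∈ L²(T, dγ)` on every elliptic Cartan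
  representative» (what makes `⟨ , ⟩_e` converge, pp. 184, 187) := ★ `K2E3L2dOfHcbLeThree.l2CharOnTorusAll_of_hcBounded` over `hHCB`, the pins `μG_eq regG_iff char_law
  cartanG_spec finG` and the two `D_G` clauses ★ `F0P3cStCharTSDGField.measurable_DG` ∕ `DG_eq_zero_or_le` from the closed form `dG_eq` — the body of the payer of
  record ★ `K2E3PseudoCoeffTraceOfPinsLeThree.pseudoCoeffTrace_of_pins` :131–133 token for token (the card's detour ★ `l2dEll_of_hcBounded` + ★
  `F0P3cStCharTSL2dEll.l2CharOnTorusAll_of_elliptic` is the same term: `l2dEll_of_hcBounded := fun π _ => l2CharOnTorusAll_of_hcBounded … π`, ★ K2E3L2dOfHcbLeThree :110);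
* §2 **`pseudoCoeffTrace_of_isRecordDatumG`** — ★ `Ch12Sec6.PseudoCoeffTrace 𝔇` (= `ExtE3FinDatum.kazhdanPseudoCoeff`.2, D1 :282): «By the Weyl integration formula,
  `Tr(π′(f_π)) = ⟨χ_{π′}, χ_π⟩_e`» (p. 187) := ONE application of ★ `K2E3PseudoCoeffTraceOfPinsLeThree.pseudoCoeffTrace_of_pins` to `hns`, `hHCB`, the frame and
  seventeen pins of `h𝔇` (argument order = LeThree :70–105).
BINDERS = the COMMON TELESCOPE of the card (= ★ `ExtE3Fin.datum` D1 :309–320 with `H` generic as in ★ `IsRecordDatumG`) with `(hHCB : normalizedCharacter_locallyBoundedLeThree)`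
inserted right after `hns` — in §1 WITHOUT the canonicity binder `hcanQ` (idle there: `L2CharOnTorusAll` reads no orbital integral; an idle named binder is a linter
warning), in §2 with it; conclusions = the field types D1 :280.2 ∕ :282.2 verbatim.  The topological instances of `Gqs L v` are synthesized (as at (W1)).
HONEST LABEL.  HC_CM is proved only modulo the 7 printed citations (2 remaining named inputs: hLiu418 = `stmt-HodgeConjecture-24832`, h413 = `stmt-HodgeConjecture-24833`)
until rung 0 closes; count-neutral — this file pays two conjuncts of a closure BUILD TARGET (rows E3.P5, E3.P6) from the record pins MODULO the sibling letter `hHCB`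
and closes NOTHING at rung 0; the LAW ∕ STRUCTURE pins of `IsRecordDatumG` stay hypotheses (the K2E3 estate's standing business); REL ≠ ★ ≠ BUILT.

## References
* [Rogawski1990] J. D. Rogawski, *Automorphic Representations of Unitary Groups in Three Variables*, Ann. of Math. Stud. 123 (1990), §12.5 pp. 182–184, §12.6 pp. 187–188
  (Prop. 12.6.1 (a); «`Tr(π′(f_π)) = ⟨χ_{π′}, χ_π⟩_e`»), §12.7 p. 193 (held scan book:rogawski1990-automorphic-representations-unitary-groups-three-variables, chunks
  p0175–p0180, p0185).
* [HarishChandra1999AdmissibleDistributions] Harish-Chandra, *Admissible Invariant Distributions on Reductive p-adic Groups* (notes by DeBacker–Sally), ULS 16 (1999),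
  Part III §16 Thm. 16.3 (local boundedness of `|D|^{1∕2} Θ_π`).
* [Kazhdan1986CuspidalGeometry] D. Kazhdan, *Cuspidal geometry of p-adic groups*, J. Analyse Math. 47 (1986), Thm. K.
-/

set_option autoImplicit false
-- the mandated namespace has the single-problem summit's repeated segment (`HodgeConjecture.HodgeConjecture`)
set_option linter.dupNamespace false

noncomputable section

open MeasureTheory Measure Filter Topology NumberField IsDedekindDomain
open scoped NNReal Matrix MatrixGroups
open Literature.MeasureTheory.Group
open Literature.NumberTheory.Rogawski1990 Literature.NumberTheory.Rogawski1990.Ch12Sec5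
open Literature.NumberTheory.Automorphic Literature.NumberTheory.Automorphic.UnitaryGroup
open Summit.HodgeConjecture.HodgeConjecture.Cruxes.H413
open Summit.HodgeConjecture.HodgeConjecture.Cruxes.H413.F0P3cStCharTSTorusDefs (hyperbolicSet)
open Summit.HodgeConjecture.HodgeConjecture.Cruxes.H413.K2E3CharLettersLeThreeDefs (normalizedCharacter_locallyBoundedLeThree)

namespace Summit.HodgeConjecture.HodgeConjecture.R90.S1

/-! ## §1 (W2a) `L2CharOnTorusAll` from the record pins, modulo `hHCB` -/

set_option synthInstance.maxHeartbeats 400000 in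
-- as the ★ payer `K2E3PseudoCoeffTraceOfPinsLeThree` does (the `Gqs L v` instance path is long)
/-- **(W2a) — row E3.P5, second conjunct (`ExtE3FinDatum.howeL2`.2), PAID FROM THE RECORD PINS MODULO `hHCB`: `D_G χ_π ∈ L²(T, dγ)` on every elliptic Cartan
representative.**  At a CM field `L`, a finite place `v` of `L⁺` that does not split in `L`, GIVEN Harish-Chandra's local boundedness `hHCB` (★
`normalizedCharacter_locallyBoundedLeThree`), a Haar measure `νQv` on `G = U(Φ₃)(L⁺_v) = Gqs L v`, a Haar `μZ` on `G ⧸ Z(G)` and an orbital family `mQv` (no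
canonicity needed here — the common telescope's `hcanQ` is omitted in this §): every §12.5 datum `𝔇 : EllipticData (Gqs L v) H` carrying the record pins ★ `IsRecordDatumG L v νQv μZ mQv 𝔇` satisfies ★ `𝔇.L2CharOnTorusAll` — for every class `π`
and every `T ∈ cartanG`, `t ↦ D_G(t) χ_π(t)` is in `L²(T, dγ)` (what makes `⟨χ_{π′}, χ_π⟩_e` converge, pp. 184, 187: `|D_G|^{1∕2}χ_π` locally bounded, `T` compact of
finite mass, `|D_G| ≤ 1` on a compact torus by the closed form of `D_G`).  Body = ★ `K2E3L2dOfHcbLeThree.l2CharOnTorusAll_of_hcBounded` over `hHCB`, the pins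
`μG_eq regG_iff char_law cartanG_spec finG` and ★ `measurable_DG` ∕ ★ `DG_eq_zero_or_le` from `dG_eq` (= ★ `pseudoCoeffTrace_of_pins` :131–133).
[cite: Rogawski1990, §12.5 p. 184; §12.6 p. 187; §12.7 p. 193] [cite: HarishChandra1999AdmissibleDistributions, Part III §16 Thm. 16.3] -/
theorem l2CharOnTorusAll_of_isRecordDatumG
    (L : Type) [Field L] [NumberField L] [IsCMField L] (v : HeightOneSpectrum (𝓞 ↥(maximalRealSubfield L)))
    (hns : ∀ w : PlacesOver L v, IsCMField.complexConj L • w.1 = w.1)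
    (hHCB : normalizedCharacter_locallyBoundedLeThree)
    [MeasurableSpace (Gqs L v)] [BorelSpace (Gqs L v)]
    [∀ γ : Gqs L v, MeasurableSpace (Gqs L v ⧸ Subgroup.centralizer ({γ} : Set (Gqs L v)))]
    [∀ γ : Gqs L v, BorelSpace (Gqs L v ⧸ Subgroup.centralizer ({γ} : Set (Gqs L v)))]
    [MeasurableSpace (Gqs L v ⧸ Subgroup.center (Gqs L v))] [BorelSpace (Gqs L v ⧸ Subgroup.center (Gqs L v))]
    {H : Type} [Group H] [TopologicalSpace H] [IsTopologicalGroup H] [MeasurableSpace H]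
    (νQv : Measure (Gqs L v)) [νQv.IsHaarMeasure] [νQv.IsMulRightInvariant]
    (μZ : Measure (Gqs L v ⧸ Subgroup.center (Gqs L v))) [μZ.IsHaarMeasure]
    (mQv : OrbitalMeasureFamily (Gqs L v))
    (𝔇 : EllipticData (Gqs L v) H) (h𝔇 : IsRecordDatumG L v νQv μZ mQv 𝔇) :
    𝔇.L2CharOnTorusAll := by
  -- the two `D_G` clauses from the closed form (pin `dG_eq`; ★ DG-FIELD)
  have hDGm : Measurable 𝔇.DG := F0P3cStCharTSDGField.measurable_DG L v 𝔇 h𝔇.dG_eq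
  have hDG := F0P3cStCharTSDGField.DG_eq_zero_or_le L v 𝔇 h𝔇.dG_eq
  -- (L2D∀) from `hHCB` + the character-law pin + compact finite-mass elliptic tori (★ L2D-OF-HCB, NR-1′ twin)
  exact K2E3L2dOfHcbLeThree.l2CharOnTorusAll_of_hcBounded L v hHCB hns νQv 𝔇 h𝔇.μG_eq h𝔇.regG_iff h𝔇.char_law hDGm
    (fun T hT => (h𝔇.cartanG_spec T hT).1) h𝔇.finG hDG

/-! ## §2 (W2b) `Ch12Sec6.PseudoCoeffTrace` from the record pins, modulo `hHCB` -/

set_option synthInstance.maxHeartbeats 400000 in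
-- as the ★ payer `K2E3PseudoCoeffTraceOfPinsLeThree` does
/-- **(W2b) — row E3.P6, second conjunct (`ExtE3FinDatum.kazhdanPseudoCoeff`.2), PAID FROM THE RECORD PINS MODULO `hHCB`: «By the Weyl integration formula,
`Tr(π′(f_π)) = ⟨χ_{π′}, χ_π⟩_e`».**  Same frame and letter as §1; conclusion ★ `Ch12Sec6.PseudoCoeffTrace 𝔇` — for every class `π′` and every pseudo-coefficient `f` of
`π` (`Φ(γ, f) = \overline{χ_π(γ)}` on `G^e`, `0` on `G^r − G^e`), `Tr π′(f) = ⟨χ_{π′}, χ_π⟩_e`.  Body = ONE application of the NR-1′ payer of record ★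
`K2E3PseudoCoeffTraceOfPinsLeThree.pseudoCoeffTrace_of_pins` (WIF from the pins + (C1)(C2)(C3) + (L2D∀) + ★ PCT-OUT inside) to `hns`, `hHCB`, the frame `νQv mQv hcanQ`
and the seventeen G-side pins of `h𝔇` it reads (all but `μGZ_eq`), in its own argument order.
[cite: Rogawski1990, §12.6 p. 187; §12.5 p. 182, p. 184] [cite: Kazhdan1986CuspidalGeometry, Thm. K] [cite: HarishChandra1999AdmissibleDistributions, Part III §16 Thm. 16.3] -/
theorem pseudoCoeffTrace_of_isRecordDatumG
    (L : Type) [Field L] [NumberField L] [IsCMField L] (v : HeightOneSpectrum (𝓞 ↥(maximalRealSubfield L)))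
    (hns : ∀ w : PlacesOver L v, IsCMField.complexConj L • w.1 = w.1)
    (hHCB : normalizedCharacter_locallyBoundedLeThree)
    [MeasurableSpace (Gqs L v)] [BorelSpace (Gqs L v)]
    [∀ γ : Gqs L v, MeasurableSpace (Gqs L v ⧸ Subgroup.centralizer ({γ} : Set (Gqs L v)))]
    [∀ γ : Gqs L v, BorelSpace (Gqs L v ⧸ Subgroup.centralizer ({γ} : Set (Gqs L v)))]
    [MeasurableSpace (Gqs L v ⧸ Subgroup.center (Gqs L v))] [BorelSpace (Gqs L v ⧸ Subgroup.center (Gqs L v))]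
    {H : Type} [Group H] [TopologicalSpace H] [IsTopologicalGroup H] [MeasurableSpace H]
    (νQv : Measure (Gqs L v)) [νQv.IsHaarMeasure] [νQv.IsMulRightInvariant]
    (μZ : Measure (Gqs L v ⧸ Subgroup.center (Gqs L v))) [μZ.IsHaarMeasure]
    (mQv : OrbitalMeasureFamily (Gqs L v))
    (hcanQ : mQv.IsCanonical (fun γ => IsRegularElt (γ.val : GL (Fin 3) (UnitaryGroup.LocalRing L v))) νQv)
    (𝔇 : EllipticData (Gqs L v) H) (h𝔇 : IsRecordDatumG L v νQv μZ mQv 𝔇) :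
    Ch12Sec6.PseudoCoeffTrace 𝔇 := by
  exact K2E3PseudoCoeffTraceOfPinsLeThree.pseudoCoeffTrace_of_pins L v hns hHCB νQv mQv hcanQ 𝔇 h𝔇.μG_eq h𝔇.orb_eq h𝔇.regG_iff
    h𝔇.ellG_iff h𝔇.char_law h𝔇.cartanAll_iff h𝔇.haarM h𝔇.cartanG_spec h𝔇.haarG h𝔇.finG h𝔇.kerG h𝔇.dG_eq h𝔇.cartanAll_cover
    h𝔇.cartanAll_nonconj h𝔇.cartanAll_cpt h𝔇.μT_inv h𝔇.μT_core

end Summit.HodgeConjecture.HodgeConjecture.R90.S1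

end
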